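import Literature.Computability.QuantumComplexity.QuadraticPolarForm
import Literature.Computability.QuantumComplexity.ForrelationSignTransport
import Summits.QuantumAdvantage.QuantumAdvantage.Theorems.CubicForrelationSignedCubicForrelationNotPrBPPStubKernelNormalFormDegree
import Summits.QuantumAdvantage.QuantumAdvantage.Theorems.CubicForrelationSignedCubicForrelationNotPrBPPStubKernelNormalFormMaps

/-!
# Crux `CubicForrelation.SignedCubicForrelationNotPrBPP` (stmt-QuantumAdvantage-13931) — line `Sketch`

Stub `stub_kernelNormalForm` (K3, the lead's stub; helper file 3/3): the KERNEL NORMAL FORM of a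
cubic Boolean function with an affine derivative.

Let `b : 𝔽₂^{n+2} → 𝔽₂` be cubic and let `h ≠ 0` be a direction in which the derivative
`D_h b (x) = b(x) ⊕ b(x ⊕ h)` is AFFINE (a "kernel direction" of the cubic tensor of `b`). Then there
is a coupled pair of bijections `(e, e')` of `𝔽₂^{n+2}` — adjoint for the characters
(the hypothesis of the landed `stub_coupledInvariance`: `Φ(a ∘ e', b ∘ e) = Φ(a, b)`), with `e'`
degree-preserving — such that `b ∘ e` is

* in PERIODIC form `x₀·c ⊕ B(x′)` with `B` cubic (when `D_h b` is constant), or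
* in KERNEL form `(x₁ ⊕ c₀)·(x₀ ⊕ B₁(x″)) ⊕ B₀(x″)` with `B₀` cubic and `B₁` quadratic.

Proof. (A) `D_h b` has degree `≤ 1`, so all its second derivatives vanish (`lowDeg` bridge of
`QuadraticPolarForm.lean`); hence `x ↦ D_h b(x) ⊕ D_h b(0)` is additive and equals `⟪x, k⟫` for the
vector `k` of its values on unit vectors (`knf_additive_eq_ip`). (B) Stage 1 (`knf_stage1`): pick
`i₀` with `h_{i₀} = 1`; the transvection `T_{i₀, h ⊕ e_{i₀}}` after the swap `P_{0,i₀}` sends `e₀` to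
`h`; its character-adjoint is `S_{i₀, h ⊕ e_{i₀}} ∘ P_{0,i₀}`; the functional `k` is transported to
`k₁` with `k₁ 0 = ⟪h, k⟫ = 0` (periodicity of `D_h b` in direction `h`). (C) If `k₁ = 0` the
derivative of `b ∘ e₁` in direction `e₀` is the constant `c₀ = D_h b(0)`: periodic form
(`knf_periodic_assembly`). (D) Otherwise Stage 2 (`knf_stage2`): swap a support index `i₁ ≠ 0` of
`k₁` to `1` and apply the transposed transvection `S_{1,κ₂}`, `κ₂ = k₁∘(1 i₁) ⊕ e₁`, which fixes `e₀`
and turns the functional into the coordinate `x₁`; then the derivative of `b ∘ e` in direction `e₀`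
is `c₀ ⊕ x₁` and the kernel form is read off (`knf_kernel_assembly`), with
`B₁(u) = b∘e(0,1,u) ⊕ b∘e(0,0,u)` QUADRATIC by the coordinate-derivative degree drop
(`knf_isDegLeFun_coord_step`) and `B₀` cubic by substitution (`knf_isDegLeFun_comp`).

Reference: C. Carlet, *Boolean Functions for Cryptography and Coding Theory* (CUP 2021), §2.2.2 and
§6.1 (derivatives lower the degree; affine derivatives = linear structures) — folklore normal form.
-/

noncomputable section

set_option linter.dupNamespace false -- D-0017: single-problem summit ⇒ QuantumAdvantage.QuantumAdvantage by design

namespace Summit.QuantumAdvantage.QuantumAdvantage.Theorems.SignedCubicForrelationNotPrBPP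

open Finset Literature.Computability.QuantumComplexity
open Literature.Computability.QuantumComplexity.BuzetChailloux (bxor zeroVec bxor_self bxor_comm
  bxor_bxor_cancel_left zeroVec_bxor bxor_zeroVec)
open Literature.Computability.QuantumComplexity.QuadPolar (toZFun toZFun_apply toZFun_mem_lowDeg_of_poly)
open Literature.Computability.QuantumComplexity.CHHL2018 (lowDeg mem_lowDeg_succ mem_lowDeg_zero der der_apply)
open Literature.Computability.Complexity.BLR (toZ toZ_xor toZ_injective)
open Literature.Computability.Complexity.LowDegree (xorVec)

variable {N : ℕ}

/-- `xorVec` (the `lowDeg` kit) is the tree's `bxor`. -/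
theorem knf_xorVec_eq_bxor (x w : Fin N → Bool) : xorVec x w = bxor x w := rfl

/-- **Affine functions are translates of linear functionals.** If `D : 𝔽₂ᴺ → 𝔽₂` has degree `≤ 1`
then `D` recentred at `0` is additive. -/
theorem knf_additive_of_isDegLeFun_one {D : (Fin N → Bool) → Bool} (hD : IsDegLeFun 1 D) (x y : Fin N → Bool) :
    (D (bxor x y) ^^ D zeroVec) = ((D x ^^ D zeroVec) ^^ (D y ^^ D zeroVec)) := by
  obtain ⟨p, hp, hDp⟩ := hD
  have hlow : toZFun D ∈ lowDeg N 1 := toZFun_mem_lowDeg_of_poly p hp hDp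
  -- the second derivative `D_y D_x [D]` vanishes; read it at the origin
  have h2 : der x (toZFun D) (xorVec zeroVec y) = der x (toZFun D) zeroVec :=
    (mem_lowDeg_zero.1 (mem_lowDeg_succ.1 hlow x)) y zeroVec
  simp only [der_apply, toZFun_apply, knf_xorVec_eq_bxor, zeroVec_bxor] at h2
  -- `h2 : toZ (D (bxor y x)) + toZ (D y) = toZ (D x) + toZ (D 0)`
  apply toZ_injective
  rw [toZ_xor, toZ_xor, toZ_xor, toZ_xor, bxor_comm]
  linear_combination h2 - (toZ (D y)) * QuadPolar.two_eq_zero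

/-- **Affine derivative, inner-product form.** If `D` has degree `≤ 1` then
`D x = D 0 ⊕ ⟪x, k⟫` with `kⱼ = D eⱼ ⊕ D 0`. -/
theorem knf_affine_form {D : (Fin N → Bool) → Bool} (hD : IsDegLeFun 1 D) (x : Fin N → Bool) :
    D x = (D zeroVec ^^ decide (Odd (Finset.card (Finset.filter
      (fun ℓ => (x ℓ && (D (fun ℓ' => decide (ℓ' = ℓ)) ^^ D zeroVec))) Finset.univ)))) := by
  have hadd := knf_additive_of_isDegLeFun_one hD
  have key := knf_additive_eq_ip (L := fun x => D x ^^ D zeroVec) hadd x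
  simp only [] at key
  rw [← key]
  cases D x <;> cases D zeroVec <;> rfl

/-! ### Assembly lemmas: reading off the normal forms from the derivative in direction `e₀` -/

/-- `x ⊕ e₀ = (¬x₀, x′)`. -/
theorem knf_bxor_E_zero {k : ℕ} (x : Fin (k + 1) → Bool) :
    bxor x (fun ℓ' => decide (ℓ' = (0 : Fin (k + 1)))) = Fin.cons (!x 0) (Fin.tail x) := by
  funext i
  refine Fin.cases ?_ (fun j => ?_) i
  · simp [bxor]
  · simp [bxor, Fin.tail, Fin.succ_ne_zero]

/-- **Periodic assembly.** If `g(x ⊕ e₀) = g(x) ⊕ c` for all `x` then `g(x) = x₀·c ⊕ g(0, x′)`. -/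
theorem knf_periodic_assembly {k : ℕ} (g : (Fin (k + 1) → Bool) → Bool) (c : Bool)
    (hg : ∀ x, g (bxor x (fun ℓ' => decide (ℓ' = (0 : Fin (k + 1))))) = (g x ^^ c)) (x : Fin (k + 1) → Bool) :
    g x = ((x 0 && c) ^^ g (Fin.cons false (Fin.tail x))) := by
  have key : ∀ (a : Bool) (t : Fin k → Bool), g (Fin.cons a t) = ((a && c) ^^ g (Fin.cons false t)) := by
    intro a t
    cases a
    · simp
    · have h1 := hg (Fin.cons false t)
      rw [knf_bxor_E_zero] at h1
      simp only [Fin.cons_zero, Fin.tail_cons, Bool.not_false] at h1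
      rw [h1]
      cases c <;> cases g (Fin.cons false t) <;> rfl
  have hx : x = Fin.cons (x 0) (Fin.tail x) := (Fin.cons_self_tail x).symm
  conv_lhs => rw [hx]
  rw [key]

/-- **Kernel assembly.** If `g(x ⊕ e₀) = g(x) ⊕ c₀ ⊕ x₁` for all `x` then
`g(x) = (x₁ ⊕ c₀)(x₀ ⊕ B₁(x″)) ⊕ B₀(x″) ⊕ c₀B₁(x″)` with `B₀(u) = g(0,0,u)`,
`B₁(u) = g(0,1,u) ⊕ g(0,0,u)`. -/
theorem knf_kernel_assembly {k : ℕ} (g : (Fin (k + 2) → Bool) → Bool) (c₀ : Bool)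
    (hg : ∀ x, g (bxor x (fun ℓ' => decide (ℓ' = (0 : Fin (k + 2))))) = ((g x ^^ c₀) ^^ x 1))
    (x : Fin (k + 2) → Bool) :
    g x = (((x 1 ^^ c₀) && (x 0 ^^ (g (Fin.cons false (Fin.cons true (Fin.tail (Fin.tail x)))) ^^
        g (Fin.cons false (Fin.cons false (Fin.tail (Fin.tail x))))))) ^^
      (g (Fin.cons false (Fin.cons false (Fin.tail (Fin.tail x)))) ^^
        (c₀ && (g (Fin.cons false (Fin.cons true (Fin.tail (Fin.tail x)))) ^^
          g (Fin.cons false (Fin.cons false (Fin.tail (Fin.tail x)))))))) := by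
  -- the value at `(1, x₁, u)` from the value at `(0, x₁, u)`
  have hstep : ∀ (x₁ : Bool) (u : Fin k → Bool),
      g (Fin.cons true (Fin.cons x₁ u)) = ((g (Fin.cons false (Fin.cons x₁ u)) ^^ c₀) ^^ x₁) := by
    intro x₁ u
    have h1 := hg (Fin.cons false (Fin.cons x₁ u))
    rw [knf_bxor_E_zero] at h1
    simpa only [Fin.cons_zero, Fin.tail_cons, Bool.not_false, Fin.cons_one] using h1
  have key : ∀ (a a' : Bool) (u : Fin k → Bool), g (Fin.cons a (Fin.cons a' u)) =
      (((a' ^^ c₀) && (a ^^ (g (Fin.cons false (Fin.cons true u)) ^^ g (Fin.cons false (Fin.cons false u))))) ^^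
        (g (Fin.cons false (Fin.cons false u)) ^^
          (c₀ && (g (Fin.cons false (Fin.cons true u)) ^^ g (Fin.cons false (Fin.cons false u)))))) := by
    intro a a' u
    generalize hP : g (Fin.cons false (Fin.cons false u)) = P
    generalize hQ : g (Fin.cons false (Fin.cons true u)) = Q
    cases a <;> cases a'
    · rw [hP]; cases c₀ <;> cases P <;> cases Q <;> rfl
    · rw [hQ]; cases c₀ <;> cases P <;> cases Q <;> rfl
    · rw [hstep, hP]; cases c₀ <;> cases P <;> cases Q <;> rfl
    · rw [hstep, hQ]; cases c₀ <;> cases P <;> cases Q <;> rfl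
  have hx : x = Fin.cons (x 0) (Fin.cons (x 1) (Fin.tail (Fin.tail x))) := by
    funext i
    refine Fin.cases rfl (fun j => ?_) i
    refine Fin.cases rfl (fun l => ?_) j
    rfl
  conv_lhs => rw [hx]
  rw [key]

/-- `c ∧ f` keeps the degree of `f`. -/
theorem knf_isDegLeFun_const_and {n d : ℕ} {f : (Fin n → Bool) → Bool} (hf : IsDegLeFun d f) (c : Bool) :
    IsDegLeFun d (fun x => c && f x) := by
  cases c
  · simpa using isDegLeFun_const (n := n) d false
  · simpa using hf

/-! ### Stage 1: move `h` to `e₀` -/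

/-- **Stage 1.** For `h ≠ 0` in `𝔽₂^{N+1}` there is a coupled pair `(e₁, e₁')` of coordinate changes —
adjoint for the characters, `e₁` additive with `e₁ e₀ = h`, both with affine coordinates — together
with the transport of every linear functional through `e₁`. (Construction: `e₁ = T_{i₀, h ⊕ e_{i₀}} ∘ P_{0,i₀}`
for an index `i₀` with `h_{i₀} = 1`, `e₁' = S_{i₀, h ⊕ e_{i₀}} ∘ P_{0,i₀}`.) -/
theorem knf_stage1 {N : ℕ} (h : Fin (N + 1) → Bool) (hh : h ≠ zeroVec) :
    ∃ e₁ e₁' : (Fin (N + 1) → Bool) ≃ (Fin (N + 1) → Bool),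
      (∀ u v, twist (e₁' u) (e₁ v) = twist u v) ∧
      (∀ x y, e₁ (bxor x y) = bxor (e₁ x) (e₁ y)) ∧
      e₁ (fun ℓ' => decide (ℓ' = (0 : Fin (N + 1)))) = h ∧
      (∀ j, IsDegLeFun 1 (fun x => e₁ x j)) ∧
      (∀ j, IsDegLeFun 1 (fun u => e₁' u j)) ∧
      (∀ k : Fin (N + 1) → Bool, ∃ k₁ : Fin (N + 1) → Bool, ∀ x,
        decide (Odd (Finset.card (Finset.filter (fun ℓ => (e₁ x ℓ && k ℓ)) Finset.univ))) =
          decide (Odd (Finset.card (Finset.filter (fun ℓ => (x ℓ && k₁ ℓ)) Finset.univ)))) := by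
  -- an index where `h` is `1`
  obtain ⟨i₀, hi₀⟩ : ∃ i, h i = true := by
    by_contra hcon
    simp only [not_exists, Bool.not_eq_true] at hcon
    exact hh (funext fun i => hcon i)
  -- the transvection vector `κ₁ = h ⊕ e_{i₀}` has `κ₁ i₀ = 0`
  set κ₁ : Fin (N + 1) → Bool := bxor h (fun ℓ' => decide (ℓ' = i₀)) with hκ₁def
  have hκ₁ : κ₁ i₀ = false := by simp [hκ₁def, bxor, hi₀]
  -- the four elementary maps
  have hAinv : Function.Involutive (fun x : Fin (N + 1) → Bool => (fun j' => (x j' ^^ (x i₀ && κ₁ j')))) :=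
    fun x => knfT_knfT hκ₁ x
  have hA'inv : Function.Involutive (fun u : Fin (N + 1) → Bool => (fun j' => (u j' ^^
      ((decide (Odd (Finset.card (Finset.filter (fun ℓ => (u ℓ && κ₁ ℓ)) Finset.univ)))) && decide (j' = i₀))))) :=
    fun u => knfS_knfS hκ₁ u
  have hPinv : Function.Involutive (fun x : Fin (N + 1) → Bool => (fun j' => x (Equiv.swap 0 i₀ j'))) :=
    fun x => knfP_knfP 0 i₀ x
  refine ⟨(hPinv.toPerm _).trans (hAinv.toPerm _), (hPinv.toPerm _).trans (hA'inv.toPerm _),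
    fun u v => ?_, fun x y => ?_, ?_, fun j => ?_, fun j => ?_, fun k => ?_⟩
  · -- adjointness: S/T at (i₀, κ₁), then P/P
    exact (knf_twist_knfS_knfT hκ₁ _ _).trans (knf_twist_knfP_knfP 0 i₀ u v)
  · -- additivity
    exact knfT_bxor i₀ κ₁ _ _
  · -- e₁ e₀ = h
    funext j
    show (decide (Equiv.swap 0 i₀ j = 0) ^^ (decide (Equiv.swap 0 i₀ i₀ = 0) && κ₁ j)) = h j
    have hj : decide (Equiv.swap 0 i₀ j = 0) = decide (j = i₀) := by
      rw [decide_eq_decide, Equiv.swap_apply_eq_iff, Equiv.swap_apply_left]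
    rw [hj, Equiv.swap_apply_right, hκ₁def]
    simp only [decide_true, Bool.true_and, bxor]
    cases h j <;> cases decide (j = i₀) <;> rfl
  · -- coordinates of e₁ are affine
    have hfun : (fun x : Fin (N + 1) → Bool => ((hPinv.toPerm _).trans (hAinv.toPerm _)) x j) =
        fun x => x (Equiv.swap 0 i₀ j) ^^ (x 0 && κ₁ j) := by
      funext x
      show ((x (Equiv.swap 0 i₀ j)) ^^ (x (Equiv.swap 0 i₀ i₀) && κ₁ j)) = _
      rw [Equiv.swap_apply_right]
    rw [hfun]
    exact knf_isDegLeFun_coord_xor_and _ _ _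
  · -- coordinates of e₁' are affine
    have hfun : (fun u : Fin (N + 1) → Bool => ((hPinv.toPerm _).trans (hA'inv.toPerm _)) u j) =
        fun u => u (Equiv.swap 0 i₀ j) ^^ ((decide (Odd (Finset.card (Finset.filter
          (fun ℓ => (u ℓ && κ₁ (Equiv.swap 0 i₀ ℓ))) Finset.univ)))) && decide (j = i₀)) := by
      funext u
      show ((u (Equiv.swap 0 i₀ j)) ^^ ((decide (Odd (Finset.card (Finset.filter
          (fun ℓ => (u (Equiv.swap 0 i₀ ℓ) && κ₁ ℓ)) Finset.univ)))) && decide (j = i₀))) = _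
      rw [knf_ip_knfP_left 0 i₀ u κ₁]
    rw [hfun]
    by_cases hji : j = i₀
    · simp only [hji, decide_true, Bool.and_true]
      simpa using knf_isDegLeFun_xor' (isDegLeFun_apply (Equiv.swap 0 i₀ i₀) le_rfl)
        (knf_isDegLeFun_ip (fun ℓ => κ₁ (Equiv.swap 0 i₀ ℓ)))
    · simp only [hji, decide_false, Bool.and_false, Bool.xor_false]
      exact isDegLeFun_apply _ le_rfl
  · -- transport of a functional
    refine ⟨fun j' => (fun j' => (k j' ^^ ((decide (Odd (Finset.card (Finset.filter
        (fun ℓ => (k ℓ && κ₁ ℓ)) Finset.univ)))) && decide (j' = i₀)))) (Equiv.swap 0 i₀ j'), fun x => ?_⟩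
    exact (knf_ip_knfT_left i₀ κ₁ _ k).trans (knf_ip_knfP_left 0 i₀ x _)

/-! ### Stage 2 (kernel case): straighten the functional to the coordinate `x₁` -/

/-- **Stage 2.** For `k₁ ∈ 𝔽₂^{N+2}` with `k₁ 0 = 0` and some `k₁ i = 1` there is a coupled pair
`(e₂, e₂')` — adjoint for the characters, `e₂` additive and FIXING `e₀`, both with affine
coordinates — such that `⟪e₂ x, k₁⟫ = x₁` for all `x`. (Construction: `e₂ = P_{1,i₁} ∘ S_{1,κ₂}`,
`e₂' = P_{1,i₁} ∘ T_{1,κ₂}` with `κ₂ = (k₁ ∘ (1 i₁)) ⊕ e₁`.) -/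
theorem knf_stage2 {N : ℕ} (k₁ : Fin (N + 2) → Bool) (hk0 : k₁ 0 = false) (hk : ∃ i, k₁ i = true) :
    ∃ e₂ e₂' : (Fin (N + 2) → Bool) ≃ (Fin (N + 2) → Bool),
      (∀ u v, twist (e₂' u) (e₂ v) = twist u v) ∧
      (∀ x y, e₂ (bxor x y) = bxor (e₂ x) (e₂ y)) ∧
      e₂ (fun ℓ' => decide (ℓ' = (0 : Fin (N + 2)))) = (fun ℓ' => decide (ℓ' = (0 : Fin (N + 2)))) ∧
      (∀ j, IsDegLeFun 1 (fun x => e₂ x j)) ∧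
      (∀ j, IsDegLeFun 1 (fun u => e₂' u j)) ∧
      (∀ x, decide (Odd (Finset.card (Finset.filter (fun ℓ => (e₂ x ℓ && k₁ ℓ)) Finset.univ))) = x 1) := by
  obtain ⟨i₁, hi₁⟩ := hk
  have hi₁0 : i₁ ≠ 0 := by rintro rfl; rw [hk0] at hi₁; exact Bool.false_ne_true hi₁
  have h01 : (0 : Fin (N + 2)) ≠ 1 := by simp
  have hσ0 : Equiv.swap (1 : Fin (N + 2)) i₁ 0 = 0 := Equiv.swap_apply_of_ne_of_ne h01 hi₁0.symm
  -- the functional in the swapped coordinates and the transvection vector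
  set kb : Fin (N + 2) → Bool := fun j' => k₁ (Equiv.swap 1 i₁ j') with hkbdef
  have hkb1 : kb 1 = true := by simp [hkbdef, hi₁]
  have hkb0 : kb 0 = false := by simp [hkbdef, hσ0, hk0]
  set κ₂ : Fin (N + 2) → Bool := bxor kb (fun ℓ' => decide (ℓ' = (1 : Fin (N + 2)))) with hκ₂def
  have hκ₂1 : κ₂ 1 = false := by simp [hκ₂def, bxor, hkb1]
  have hκ₂0 : κ₂ 0 = false := by simp [hκ₂def, bxor, hkb0]
  have hTkb : (fun j' => (kb j' ^^ (kb 1 && κ₂ j'))) = (fun ℓ' => decide (ℓ' = (1 : Fin (N + 2)))) := by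
    funext j
    rw [hkb1, Bool.true_and, hκ₂def]
    simp only [bxor]
    cases kb j <;> cases decide (j = 1) <;> rfl
  -- the elementary maps
  have hGinv : Function.Involutive (fun x : Fin (N + 2) → Bool => (fun j' => (x j' ^^
      ((decide (Odd (Finset.card (Finset.filter (fun ℓ => (x ℓ && κ₂ ℓ)) Finset.univ)))) && decide (j' = 1))))) :=
    fun x => knfS_knfS hκ₂1 x
  have hG'inv : Function.Involutive (fun u : Fin (N + 2) → Bool => (fun j' => (u j' ^^ (u 1 && κ₂ j')))) :=
    fun u => knfT_knfT hκ₂1 u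
  have hPinv : Function.Involutive (fun x : Fin (N + 2) → Bool => (fun j' => x (Equiv.swap 1 i₁ j'))) :=
    fun x => knfP_knfP 1 i₁ x
  refine ⟨(hGinv.toPerm _).trans (hPinv.toPerm _), (hG'inv.toPerm _).trans (hPinv.toPerm _),
    fun u v => ?_, fun x y => ?_, ?_, fun j => ?_, fun j => ?_, fun x => ?_⟩
  · -- adjointness: P/P then T/S at (1, κ₂)
    exact (knf_twist_knfP_knfP 1 i₁ _ _).trans (knf_twist_knfT_knfS hκ₂1 u v)
  · -- additivity
    show (fun j' => (fun j' => ((bxor x y) j' ^^ ((decide (Odd (Finset.card (Finset.filter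
        (fun ℓ => ((bxor x y) ℓ && κ₂ ℓ)) Finset.univ)))) && decide (j' = 1)))) (Equiv.swap 1 i₁ j')) = _
    rw [knfS_bxor 1 κ₂ x y]
    rfl
  · -- e₂ fixes e₀
    have hfix := knfS_of_ip_false (i := (1 : Fin (N + 2))) (κ := κ₂)
      (u := fun ℓ' => decide (ℓ' = (0 : Fin (N + 2)))) (by rw [knf_ip_E_left]; exact hκ₂0)
    show (fun j' => (fun j' => ((fun ℓ' => decide (ℓ' = (0 : Fin (N + 2)))) j' ^^ ((decide (Odd (Finset.card
        (Finset.filter (fun ℓ => ((fun ℓ' => decide (ℓ' = (0 : Fin (N + 2)))) ℓ && κ₂ ℓ)) Finset.univ)))) &&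
        decide (j' = 1)))) (Equiv.swap 1 i₁ j')) = _
    rw [hfix]
    exact knfP_E_of_ne h01 hi₁0.symm
  · -- coordinates of e₂ are affine
    have hfun : (fun x : Fin (N + 2) → Bool => ((hGinv.toPerm _).trans (hPinv.toPerm _)) x j) =
        fun x => x (Equiv.swap 1 i₁ j) ^^ ((decide (Odd (Finset.card (Finset.filter
          (fun ℓ => (x ℓ && κ₂ ℓ)) Finset.univ)))) && decide (Equiv.swap 1 i₁ j = 1)) := by
      funext x; rfl
    rw [hfun]
    by_cases hj1 : Equiv.swap 1 i₁ j = 1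
    · simp only [hj1, decide_true, Bool.and_true]
      simpa using knf_isDegLeFun_xor' (isDegLeFun_apply (1 : Fin (N + 2)) le_rfl) (knf_isDegLeFun_ip κ₂)
    · simp only [hj1, decide_false, Bool.and_false, Bool.xor_false]
      exact isDegLeFun_apply _ le_rfl
  · -- coordinates of e₂' are affine
    have hfun : (fun u : Fin (N + 2) → Bool => ((hG'inv.toPerm _).trans (hPinv.toPerm _)) u j) =
        fun u => u (Equiv.swap 1 i₁ j) ^^ (u 1 && κ₂ (Equiv.swap 1 i₁ j)) := by
      funext u; rfl
    rw [hfun]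
    exact knf_isDegLeFun_coord_xor_and _ _ _
  · -- the functional becomes the coordinate x₁
    have step1 := knf_ip_knfP_left 1 i₁ (fun j' => (x j' ^^ ((decide (Odd (Finset.card (Finset.filter
        (fun ℓ => (x ℓ && κ₂ ℓ)) Finset.univ)))) && decide (j' = 1)))) k₁
    have step2 := knf_ip_knfS_left 1 κ₂ x kb
    have step3 := congrArg (fun w : Fin (N + 2) → Bool =>
      decide (Odd (Finset.card (Finset.filter (fun ℓ => (x ℓ && w ℓ)) Finset.univ)))) hTkb
    have step4 := knf_ip_E_right x (1 : Fin (N + 2))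
    exact step1.trans (step2.trans (step3.trans step4))

/-! ### The registered stub -/

/-- **`stub_kernelNormalForm` (K3 of line `Sketch`).** Let `b` be cubic on `n + 2` bits with an AFFINE
derivative in a direction `h ≠ 0`. Then there is a coupled pair of bijections `(e, e')` — adjoint for
the characters, `e'` degree-preserving — such that `b ∘ e` is in PERIODIC form `x₀·c ⊕ B(x′)`
(`B` cubic) or in KERNEL form `(x₁ ⊕ c₀)(x₀ ⊕ B₁(x″)) ⊕ B₀(x″)` (`B₀` cubic, `B₁` quadratic). -/
theorem stub_kernelNormalForm :
    ∀ (n : ℕ) (b : (Fin (n + 2) → Bool) → Bool) (h : Fin (n + 2) → Bool),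
      h ≠ zeroVec → IsDegLeFun 3 b → IsDegLeFun 1 (fun x => b x ^^ b (bxor x h)) →
      ∃ e e' : (Fin (n + 2) → Bool) ≃ (Fin (n + 2) → Bool),
        (∀ u v, twist (e' u) (e v) = twist u v) ∧
        (∀ (d : ℕ) (f : (Fin (n + 2) → Bool) → Bool), IsDegLeFun d f → IsDegLeFun d (fun x => f (e' x))) ∧
        ((∃ (c : Bool) (B : (Fin (n + 1) → Bool) → Bool), IsDegLeFun 3 B ∧
            ∀ x, b (e x) = ((x 0 && c) ^^ B (Fin.tail x))) ∨
         (∃ (c₀ : Bool) (B₀ B₁ : (Fin n → Bool) → Bool), IsDegLeFun 3 B₀ ∧ IsDegLeFun 2 B₁ ∧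
            ∀ x, b (e x) =
              (((x 1 ^^ c₀) && (x 0 ^^ B₁ (Fin.tail (Fin.tail x)))) ^^ B₀ (Fin.tail (Fin.tail x))))) := by
  intro n b h hh hb hder
  -- (A) the affine derivative in inner-product form: `D x = c₀ ⊕ ⟪x, k⟫`
  obtain ⟨k, hk⟩ : ∃ k : Fin (n + 2) → Bool, ∀ x, (b x ^^ b (bxor x h)) =
      ((b zeroVec ^^ b (bxor zeroVec h)) ^^
        decide (Odd (Finset.card (Finset.filter (fun ℓ => (x ℓ && k ℓ)) Finset.univ)))) :=
    ⟨_, knf_affine_form hder⟩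
  set c₀ : Bool := (b zeroVec ^^ b (bxor zeroVec h)) with hc₀
  -- (B) stage 1: `h ↦ e₀`
  obtain ⟨e₁, e₁', hadj₁, hadd₁, he₁0, hdeg₁, hdeg₁', htr₁⟩ := knf_stage1 h hh
  obtain ⟨k₁, hk₁⟩ := htr₁ k
  have hder₁ : ∀ x, (b (e₁ x) ^^ b (e₁ (bxor x (fun ℓ' => decide (ℓ' = (0 : Fin (n + 2))))))) =
      (c₀ ^^ decide (Odd (Finset.card (Finset.filter (fun ℓ => (x ℓ && k₁ ℓ)) Finset.univ)))) := by
    intro x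
    rw [hadd₁, he₁0, hk, hk₁]
  have he₁zero : e₁ zeroVec = zeroVec := by
    have h1 := hadd₁ zeroVec zeroVec
    rwa [bxor_self, bxor_self] at h1
  have hk₁0 : k₁ 0 = false := by
    have h1 := hder₁ (fun ℓ' => decide (ℓ' = (0 : Fin (n + 2))))
    rw [bxor_self, he₁zero, he₁0, knf_ip_E_left, hc₀, zeroVec_bxor] at h1
    revert h1
    cases b h <;> cases b zeroVec <;> cases k₁ 0 <;> decide
  by_cases hcase : ∃ i, k₁ i = true
  · -- (C) KERNEL CASE: stage 2 straightens the functional to `x₁`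
    obtain ⟨e₂, e₂', hadj₂, hadd₂, he₂0, hdeg₂, hdeg₂', hfun₂⟩ := knf_stage2 k₁ hk₁0 hcase
    refine ⟨e₂.trans e₁, e₂'.trans e₁', fun u v => (hadj₁ _ _).trans (hadj₂ u v), fun d f hf => ?_, Or.inr ?_⟩
    · exact knf_isDegLeFun_comp (knf_isDegLeFun_comp hf (fun y => e₁' y) hdeg₁') (fun x => e₂' x) hdeg₂'
    · have hgder : ∀ x, b (e₁ (e₂ (bxor x (fun ℓ' => decide (ℓ' = (0 : Fin (n + 2))))))) =
          ((b (e₁ (e₂ x)) ^^ c₀) ^^ x 1) := by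
        intro x
        rw [hadd₂, he₂0]
        have h1 := hder₁ (e₂ x)
        rw [hfun₂] at h1
        revert h1
        cases b (e₁ (e₂ x)) <;>
          cases b (e₁ (bxor (e₂ x) (fun ℓ' => decide (ℓ' = (0 : Fin (n + 2)))))) <;>
            cases c₀ <;> cases x 1 <;> decide
      have hgcub : IsDegLeFun 3 (fun x => b (e₁ (e₂ x))) :=
        knf_isDegLeFun_comp (knf_isDegLeFun_comp hb (fun y => e₁ y) hdeg₁) (fun x => e₂ x) hdeg₂
      have hB1 : IsDegLeFun 2 (fun u : Fin n → Bool =>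
          b (e₁ (e₂ (Fin.cons false (Fin.cons true u)))) ^^ b (e₁ (e₂ (Fin.cons false (Fin.cons false u))))) :=
        knf_isDegLeFun_coord_step hgcub
      have hB00 : IsDegLeFun 3 (fun u : Fin n → Bool => b (e₁ (e₂ (Fin.cons false (Fin.cons false u))))) :=
        knf_isDegLeFun_comp hgcub _ (knf_isDegLeFun_cons_cons_coord false false)
      refine ⟨c₀, fun u => b (e₁ (e₂ (Fin.cons false (Fin.cons false u)))) ^^
          (c₀ && (b (e₁ (e₂ (Fin.cons false (Fin.cons true u)))) ^^ b (e₁ (e₂ (Fin.cons false (Fin.cons false u)))))),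
        fun u => b (e₁ (e₂ (Fin.cons false (Fin.cons true u)))) ^^ b (e₁ (e₂ (Fin.cons false (Fin.cons false u)))),
        ?_, hB1, fun x => ?_⟩
      · simpa using knf_isDegLeFun_xor' hB00 (knf_isDegLeFun_const_and hB1 c₀)
      · exact knf_kernel_assembly (fun x => b (e₁ (e₂ x))) c₀ hgder x
  · -- (D) PERIODIC CASE: `k₁ = 0`
    have hk₁z : k₁ = zeroVec := by
      funext i
      simp only [not_exists, Bool.not_eq_true] at hcase
      exact hcase i
    refine ⟨e₁, e₁', hadj₁, fun d f hf => knf_isDegLeFun_comp hf (fun y => e₁' y) hdeg₁', Or.inl ?_⟩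
    refine ⟨c₀, fun t => b (e₁ (Fin.cons false t)), ?_, fun x => ?_⟩
    · exact knf_isDegLeFun_comp (knf_isDegLeFun_comp hb (fun y => e₁ y) hdeg₁) _ (knf_isDegLeFun_cons_coord false)
    · have hgder : ∀ x, b (e₁ (bxor x (fun ℓ' => decide (ℓ' = (0 : Fin (n + 2)))))) = (b (e₁ x) ^^ c₀) := by
        intro x
        have h1 := hder₁ x
        rw [hk₁z, knf_ip_zero_right] at h1
        revert h1
        cases b (e₁ x) <;> cases b (e₁ (bxor x (fun ℓ' => decide (ℓ' = (0 : Fin (n + 2)))))) <;> cases c₀ <;> decide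
      exact knf_periodic_assembly (fun x => b (e₁ x)) c₀ hgder x

end Summit.QuantumAdvantage.QuantumAdvantage.Theorems.SignedCubicForrelationNotPrBPP

end
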